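import Summits.Ventures.Crystal3D.Theorems.StickyWulffConstantGenericWallFloorSaturationStructure
import Summits.Ventures.Crystal3D.Theorems.StickyWulffConstantGenericWallFloorSlotDozens
import Summits.Ventures.Crystal3D.Theorems.StickyWulffConstantGenericWallFloorSlotTriples
import Summits.Ventures.Crystal3D.Theorems.StickyWulffConstantGenericWallFloorStepGain
import Summits.Ventures.Crystal3D.Theorems.StickyWulffConstantGenericWallFloorCredits
import Summits.Ventures.Crystal3D.Theorems.StickyWulffConstantGenericWallFloorCommonSlots
import Summits.Ventures.Crystal3D.Theorems.StickyWulffConstantGenericWallFloorMixedDozenRules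
import Mathlib.Analysis.InnerProductSpace.Projection.Reflection
import HarnessLib

/-!
# The dozen step of a slot line: continue (fcc shell or twin dozen) or pay within contact distance 1

HONEST FRAMING. Part of the venture `Summits/Ventures/Crystal3D` (cell `crystal3d-full`), helper for the
crux `GenericWallFloor` (stmt-Ventures-19480) of `route-Ventures-StickyWulffConstant`, REGISTERED line
`WallLedgerG` (planner cf-p1 gen 16/22), open stub `stub_twoSlabAdhesion : TwoSlabAdhesion` (general
fillings; cf-p1 ROUTE.md §80, INBOX 20:20:54Z «land the monotone-Barlow-lines floor as a frontier rung»).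
Rung credit only; F-C1 not moved.

THE STEP (brick N2 of 19480-p1's GENERAL-FILLING-ARCH memo, with the payer distance improved from 3 to 1
and NO «predecessor has a full shell» hypothesis).  `X` a finite `1`-separated configuration, `A` a grain
frame, `y ∈ X` a ball with THREE LINEARLY INDEPENDENT EXACT SLOT NEIGHBOURS `y + A a, y + A b, y + A c ∈ X`.

* `fullShell_or_twinDozen_of_allButOne` — if `y` and all its contact neighbours but at most one are
  saturated then (inputs `KissingGap δ`, `KissingClassification δ` BY NAME, via
  `exists_frame_of_allButOne`; single-dozen algebra `fccDozen_eq_slots_of_three_independent` /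
  `hcpDozen_twin_of_three_independent` of crystal3d-wulff-p2) EITHER the whole slot shell `y + A(fccSlots)`
  is occupied, OR there is a `{111}` unit normal `n` of the grain (`⟪A w, n⟫ ∈ {0, ±√(2/3)}`) with: the nine
  slots `⟪A w, n⟫ ≤ 0` occupied, the three mirror sites `y + A w − 2⟪A w, n⟫ n` (`⟪A w, n⟫ < 0`) occupied,
  the three slots `⟪A w, n⟫ > 0` EMPTY, and `a, b, c` on the own side.
* `line_step` — unconditionally: some ball `z ∈ X` with `dist y z ≤ 1` has `≤ 11` contacts, or one of
  the two alternatives above.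
* `exists_exact_neighbours_fcc_step` — after an fcc step `y ↦ y + A u` (full shell at `y`) the new ball
  again has three independent exact slot neighbours (hemisphere lemma of crystal3d-wulff-p2 at `ν = A u`).
* `exists_twinFrame`, `exists_exact_neighbours_twin_step` — after a twin step `y ↦ y + A' w₀`
  (`⟪A w₀, n⟫ < 0`, twin frame `A' x = A x − 2⟪A x, n⟫ n`) the new ball has three independent exact slot
  neighbours IN THE TWIN FRAME `A'`.

So a slot line can always be continued — in the same frame or in the twin frame — unless it PAYS at
contact distance `≤ 1`; this is the local engine of the monotone-Barlow-lines floor (sources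
`card_exits_ge`, rise `exists_capper_rise`; in-degree and assembly are the remaining bricks).

WHAT THIS IS NOT: not the stub; no counting; F-C1 not moved.
-/

noncomputable section

namespace Summit.Ventures.Crystal3D.Theorems

open Summit.Ventures.Crystal3D Finset
open Literature.Geometry.DiscreteGeometry (fccKissingPattern hcpKissingPattern)
open Literature.MathematicalPhysics.StatisticalMechanics (fccStacking)
open scoped InnerProductSpace

variable {X : Finset (EuclideanSpace ℝ (Fin 3))}

/-! ### The dozen step -/

/-- **Dozen step.**  See the module docstring. -/
theorem fullShell_or_twinDozen_of_allButOne {δ : ℝ} (hg : KissingGap δ) (hc : KissingClassification δ)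
    (hX : ∀ p ∈ X, ∀ q ∈ X, p ≠ q → 1 ≤ dist p q) {y : EuclideanSpace ℝ (Fin 3)}
    (h12 : (X.filter fun q => dist y q = 1).card = 12) (y₀ : EuclideanSpace ℝ (Fin 3))
    (hnb : ∀ z ∈ X, dist y z = 1 → z ≠ y₀ → (X.filter fun q => dist z q = 1).card = 12)
    (A : EuclideanSpace ℝ (Fin 3) ≃ₗᵢ[ℝ] EuclideanSpace ℝ (Fin 3)) {a b c : EuclideanSpace ℝ (Fin 3)}
    (ha : a ∈ fccSlots) (hb : b ∈ fccSlots) (hc' : c ∈ fccSlots) (hind : LinearIndependent ℝ ![a, b, c])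
    (haX : y + A a ∈ X) (hbX : y + A b ∈ X) (hcX : y + A c ∈ X) :
    (∀ w ∈ fccSlots, y + A w ∈ X) ∨
    ∃ n : EuclideanSpace ℝ (Fin 3), ‖n‖ = 1 ∧
      (∀ w ∈ fccSlots, ⟪A w, n⟫_ℝ = 0 ∨ ⟪A w, n⟫_ℝ = Real.sqrt (2 / 3) ∨ ⟪A w, n⟫_ℝ = -Real.sqrt (2 / 3)) ∧
      (∀ w ∈ fccSlots, ⟪A w, n⟫_ℝ ≤ 0 → y + A w ∈ X) ∧
      (∀ w ∈ fccSlots, ⟪A w, n⟫_ℝ < 0 → y + (A w - (2 * ⟪A w, n⟫_ℝ) • n) ∈ X) ∧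
      (∀ w ∈ fccSlots, 0 < ⟪A w, n⟫_ℝ → y + A w ∉ X) ∧
      ⟪A a, n⟫_ℝ ≤ 0 ∧ ⟪A b, n⟫_ℝ ≤ 0 ∧ ⟪A c, n⟫_ℝ ≤ 0 := by
  obtain ⟨P, B, hP, hocc, hall⟩ := exists_frame_of_allButOne hg hc hX h12 y₀ hnb
  have key : ∀ w ∈ fccSlots, y + A w ∈ X →
      A w ∈ B '' (↑P : Set (EuclideanSpace ℝ (Fin 3))) := by
    intro w hw hwX
    have hd : dist y (y + A w) = 1 := by
      rw [dist_self_add_right, LinearIsometryEquiv.norm_map, norm_eq_one_of_mem_fccSlots hw]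
    obtain ⟨p, hp, he⟩ := hall _ hwX hd
    exact ⟨p, Finset.mem_coe.2 hp, (add_left_cancel he).symm⟩
  have back : ∀ v ∈ B '' (↑P : Set (EuclideanSpace ℝ (Fin 3))), y + v ∈ X := by
    rintro v ⟨p, hp, rfl⟩; exact (hocc p (Finset.mem_coe.1 hp)).1
  have slotA : ∀ w ∈ fccSlots, A w ∈ A '' (↑fccSlots : Set (EuclideanSpace ℝ (Fin 3))) :=
    fun w hw => ⟨w, Finset.mem_coe.2 hw, rfl⟩
  have hind' : LinearIndependent ℝ ![A a, A b, A c] := linearIndependent_map_triple A hind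
  rcases hP with rfl | rfl
  · left
    have hEq := fccDozen_eq_slots_of_three_independent A B (key a ha haX) (key b hb hbX) (key c hc' hcX)
      (slotA a ha) (slotA b hb) (slotA c hc') hind'
    intro w hw
    apply back
    rw [hEq]; exact slotA w hw
  · right
    obtain ⟨n, hn, hmenu, hD⟩ := hcpDozen_twin_of_three_independent A B (key a ha haX) (key b hb hbX)
      (key c hc' hcX) (slotA a ha) (slotA b hb) (slotA c hc') hind'
    refine ⟨n, hn, hmenu, ?_, ?_, ?_, (slot_mem_twinDozen_iff A hn hmenu hD ha).1 (key a ha haX),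
      (slot_mem_twinDozen_iff A hn hmenu hD hb).1 (key b hb hbX),
      (slot_mem_twinDozen_iff A hn hmenu hD hc').1 (key c hc' hcX)⟩
    · intro w hw hle
      apply back; rw [hD]; exact Or.inl ⟨w, ⟨hw, hle⟩, rfl⟩
    · intro w hw hlt
      apply back; rw [hD]; exact Or.inr ⟨w, ⟨hw, hlt⟩, rfl⟩
    · intro w hw hpos hwX
      have := (slot_mem_twinDozen_iff A hn hmenu hD hw).1 (key w hw hwX)
      linarith

/-- **Line step.**  Unconditionally: a ball `y ∈ X` with three independent exact slot neighbours pays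
within contact distance `1` (some `z ∈ X`, `dist y z ≤ 1`, has at most eleven contacts), or has its
full slot shell, or has a twin dozen as in `fullShell_or_twinDozen_of_allButOne`. -/
theorem line_step {δ : ℝ} (hg : KissingGap δ) (hc : KissingClassification δ)
    (hX : ∀ p ∈ X, ∀ q ∈ X, p ≠ q → 1 ≤ dist p q) {y : EuclideanSpace ℝ (Fin 3)} (hy : y ∈ X)
    (A : EuclideanSpace ℝ (Fin 3) ≃ₗᵢ[ℝ] EuclideanSpace ℝ (Fin 3)) {a b c : EuclideanSpace ℝ (Fin 3)}
    (ha : a ∈ fccSlots) (hb : b ∈ fccSlots) (hc' : c ∈ fccSlots) (hind : LinearIndependent ℝ ![a, b, c])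
    (haX : y + A a ∈ X) (hbX : y + A b ∈ X) (hcX : y + A c ∈ X) :
    (∃ z ∈ X, dist y z ≤ 1 ∧ (X.filter fun q => dist z q = 1).card ≤ 11) ∨
    (∀ w ∈ fccSlots, y + A w ∈ X) ∨
    ∃ n : EuclideanSpace ℝ (Fin 3), ‖n‖ = 1 ∧
      (∀ w ∈ fccSlots, ⟪A w, n⟫_ℝ = 0 ∨ ⟪A w, n⟫_ℝ = Real.sqrt (2 / 3) ∨ ⟪A w, n⟫_ℝ = -Real.sqrt (2 / 3)) ∧
      (∀ w ∈ fccSlots, ⟪A w, n⟫_ℝ ≤ 0 → y + A w ∈ X) ∧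
      (∀ w ∈ fccSlots, ⟪A w, n⟫_ℝ < 0 → y + (A w - (2 * ⟪A w, n⟫_ℝ) • n) ∈ X) ∧
      (∀ w ∈ fccSlots, 0 < ⟪A w, n⟫_ℝ → y + A w ∉ X) ∧
      ⟪A a, n⟫_ℝ ≤ 0 ∧ ⟪A b, n⟫_ℝ ≤ 0 ∧ ⟪A c, n⟫_ℝ ≤ 0 := by
  by_cases h12 : (X.filter fun q => dist y q = 1).card = 12
  · by_cases hnb : ∀ z ∈ X, dist y z = 1 → z ≠ y → (X.filter fun q => dist z q = 1).card = 12
    · exact Or.inr (fullShell_or_twinDozen_of_allButOne hg hc hX h12 y hnb A ha hb hc' hind haX hbX hcX)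
    · left
      push Not at hnb
      obtain ⟨z, hz, hd, -, hne⟩ := hnb
      have := card_filter_dist_eq_one_le_twelve X hX z
      exact ⟨z, hz, hd.le, by omega⟩
  · left
    have := card_filter_dist_eq_one_le_twelve X hX y
    exact ⟨y, hy, by rw [dist_self]; norm_num, by omega⟩

/-! ### The successor again has three independent exact slot neighbours -/

/-- Two slots at an obtuse angle: `⟪w, u⟫ < 0` forces `w = −u` or `u + w` is a slot. -/
theorem eq_neg_or_add_mem_fccSlots_of_inner_neg {u w : EuclideanSpace ℝ (Fin 3)}
    (hu : u ∈ fccSlots) (hw : w ∈ fccSlots) (hneg : ⟪w, u⟫_ℝ < 0) : w = -u ∨ u + w ∈ fccSlots := by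
  have hu1 := norm_eq_one_of_mem_fccSlots hu
  have hw1 := norm_eq_one_of_mem_fccSlots hw
  have hmenu := inner_mem_of_unit_slots (LinearIsometryEquiv.refl ℝ (EuclideanSpace ℝ (Fin 3)))
    (a := w) (b := u) ⟨w, mem_fcc_of_mem_fccSlots hw, rfl⟩ ⟨u, mem_fcc_of_mem_fccSlots hu, rfl⟩ hw1 hu1
  have hsq : ‖u + w‖ ^ 2 = 2 + 2 * ⟪w, u⟫_ℝ := by
    rw [norm_add_sq_real, hu1, hw1, real_inner_comm]; ring
  rcases hmenu with h | h | h | h | h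
  · linarith
  · linarith
  · linarith
  · right
    refine mem_fccSlots_of_unit (fcc_add_site_mem (mem_fcc_of_mem_fccSlots hu) (mem_fcc_of_mem_fccSlots hw)) ?_
    have : ‖u + w‖ ^ 2 = 1 := by rw [hsq, h]; norm_num
    nlinarith [norm_nonneg (u + w)]
  · left
    have : ‖u + w‖ ^ 2 = 0 := by rw [hsq, h]; norm_num
    have h0 : u + w = 0 := by
      rwa [sq_eq_zero_iff, norm_eq_zero] at this
    exact eq_neg_of_add_eq_zero_right h0

/-- **fcc step.**  If the whole slot shell of `y ∈ X` is occupied then, for every slot `u`, the ball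
`y + A u` has three linearly independent exact slot neighbours (frame `A`). -/
theorem exists_exact_neighbours_fcc_step
    (A : EuclideanSpace ℝ (Fin 3) ≃ₗᵢ[ℝ] EuclideanSpace ℝ (Fin 3)) {y : EuclideanSpace ℝ (Fin 3)}
    (hy : y ∈ X) (hfull : ∀ w ∈ fccSlots, y + A w ∈ X) {u : EuclideanSpace ℝ (Fin 3)} (hu : u ∈ fccSlots) :
    ∃ a ∈ fccSlots, ∃ b ∈ fccSlots, ∃ c ∈ fccSlots, LinearIndependent ℝ ![a, b, c] ∧
      y + A u + A a ∈ X ∧ y + A u + A b ∈ X ∧ y + A u + A c ∈ X := by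
  have hAu : A u ≠ 0 := by
    rw [← norm_ne_zero_iff, LinearIsometryEquiv.norm_map, norm_eq_one_of_mem_fccSlots hu]; norm_num
  obtain ⟨a, ha, b, hb, c, hc, ha', hb', hc', hind⟩ := exists_independent_slots_of_hemisphere A hAu
  have occ : ∀ w ∈ fccSlots, ⟪A w, A u⟫_ℝ < 0 → y + A u + A w ∈ X := by
    intro w hw hneg
    rw [LinearIsometryEquiv.inner_map_map] at hneg
    rcases eq_neg_or_add_mem_fccSlots_of_inner_neg hu hw hneg with rfl | hs
    · rw [map_neg, add_neg_cancel_right]; exact hy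
    · rw [add_assoc, ← map_add]; exact hfull _ hs
  exact ⟨a, ha, b, hb, c, hc, hind, occ a ha ha', occ b hb hb', occ c hc hc'⟩

/-- **The twin frame exists**: `x ↦ A x − 2⟪A x, n⟫ n` (`n` a unit vector) is a linear isometry of `ℝ³`
(the mirror across `nᗮ` after `A`). -/
theorem exists_twinFrame (A : EuclideanSpace ℝ (Fin 3) ≃ₗᵢ[ℝ] EuclideanSpace ℝ (Fin 3))
    {n : EuclideanSpace ℝ (Fin 3)} (hn : ‖n‖ = 1) :
    ∃ A' : EuclideanSpace ℝ (Fin 3) ≃ₗᵢ[ℝ] EuclideanSpace ℝ (Fin 3),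
      ∀ x, A' x = A x - (2 * ⟪A x, n⟫_ℝ) • n := by
  refine ⟨A.trans (ℝ ∙ n)ᗮ.reflection, fun x => ?_⟩
  rw [LinearIsometryEquiv.trans_apply, Submodule.reflection_orthogonal_apply,
    Submodule.reflection_singleton_apply, hn, real_inner_comm]
  simp only [RCLike.ofReal_real_eq_id, id_eq, one_pow, div_one, neg_sub]
  module

/-- **Twin step.**  In the twin-dozen alternative (normal `n`, own side occupied, mirror sites occupied,
far slots empty), for a near-polar slot `w₀` (`⟪A w₀, n⟫ < 0`) and the twin frame `A'`, the mirror ball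
`y + A' w₀` has three linearly independent exact slot neighbours IN THE FRAME `A'`. -/
theorem exists_exact_neighbours_twin_step
    (A A' : EuclideanSpace ℝ (Fin 3) ≃ₗᵢ[ℝ] EuclideanSpace ℝ (Fin 3)) {y n : EuclideanSpace ℝ (Fin 3)}
    (hy : y ∈ X) (hn : ‖n‖ = 1)
    (hmenu : ∀ w ∈ fccSlots, ⟪A w, n⟫_ℝ = 0 ∨ ⟪A w, n⟫_ℝ = Real.sqrt (2 / 3) ∨ ⟪A w, n⟫_ℝ = -Real.sqrt (2 / 3))
    (hown : ∀ w ∈ fccSlots, ⟪A w, n⟫_ℝ ≤ 0 → y + A w ∈ X)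
    (hmirror : ∀ w ∈ fccSlots, ⟪A w, n⟫_ℝ < 0 → y + (A w - (2 * ⟪A w, n⟫_ℝ) • n) ∈ X)
    (hA' : ∀ x, A' x = A x - (2 * ⟪A x, n⟫_ℝ) • n)
    {w₀ : EuclideanSpace ℝ (Fin 3)} (hw₀ : w₀ ∈ fccSlots) (hw₀n : ⟪A w₀, n⟫_ℝ < 0) :
    ∃ a ∈ fccSlots, ∃ b ∈ fccSlots, ∃ c ∈ fccSlots, LinearIndependent ℝ ![a, b, c] ∧
      y + A' w₀ + A' a ∈ X ∧ y + A' w₀ + A' b ∈ X ∧ y + A' w₀ + A' c ∈ X := by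
  obtain ⟨h23, hr⟩ := sqrt_twoThirds_facts
  have hrpos : 0 < Real.sqrt (2 / 3) := by linarith
  have hAw : A' w₀ ≠ 0 := by
    rw [← norm_ne_zero_iff, LinearIsometryEquiv.norm_map, norm_eq_one_of_mem_fccSlots hw₀]; norm_num
  obtain ⟨a, ha, b, hb, c, hc, ha', hb', hc', hind⟩ := exists_independent_slots_of_hemisphere A' hAw
  -- occupied `A'`-slots of `y`: own in-plane slots, mirror sites of near-polar slots
  have occA' : ∀ p ∈ fccSlots, ⟪A p, n⟫_ℝ ≤ 0 → y + A' p ∈ X := by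
    intro p hp hle
    rcases (lt_or_eq_of_le hle) with hlt | heq
    · rw [hA']; exact hmirror p hp hlt
    · have : A' p = A p := by rw [hA', heq, mul_zero, zero_smul, sub_zero]
      rw [this]; exact hown p hp hle
  -- a slot ADJACENT to the near-polar slot `w₀` is not far
  have adj_le : ∀ p ∈ fccSlots, ⟪p, w₀⟫_ℝ = 1 / 2 → ⟪A p, n⟫_ℝ ≤ 0 := by
    intro p hp hpw
    rcases hmenu p hp with h | h | h
    · rw [h]
    · exfalso
      -- `p` far and `−w₀` far ⇒ `⟪p, −w₀⟫ ∈ {1, 1/2}` ⇒ `⟪p, w₀⟫ ≤ −1/2`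
      have hw₀v : ⟪A w₀, n⟫_ℝ = -Real.sqrt (2 / 3) := by
        rcases hmenu w₀ hw₀ with h' | h' | h'
        · rw [h'] at hw₀n; exact absurd hw₀n (lt_irrefl 0)
        · rw [h'] at hw₀n; linarith
        · exact h'
      have hnegfar : ⟪A (-w₀), n⟫_ℝ = Real.sqrt (2 / 3) := by rw [map_neg, inner_neg_left, hw₀v, neg_neg]
      by_cases hpe : A p = A (-w₀)
      · have : p = -w₀ := A.injective hpe
        rw [this, inner_neg_left, real_inner_self_eq_norm_sq, norm_eq_one_of_mem_fccSlots hw₀] at hpw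
        norm_num at hpw
      · have hhalf := inner_eq_half_of_far_slots A (a := A p) (b := A (-w₀))
          ⟨p, mem_fcc_of_mem_fccSlots hp, rfl⟩ ⟨-w₀, mem_fcc_of_mem_fccSlots (neg_mem_fccSlots hw₀), rfl⟩
          (by rw [LinearIsometryEquiv.norm_map, norm_eq_one_of_mem_fccSlots hp])
          (by rw [LinearIsometryEquiv.norm_map, norm_eq_one_of_mem_fccSlots (neg_mem_fccSlots hw₀)])
          hn h hnegfar hpe
        rw [LinearIsometryEquiv.inner_map_map, inner_neg_right, hpw] at hhalf
        norm_num at hhalf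
    · rw [h]; exact neg_nonpos.2 hrpos.le
  have occ : ∀ s ∈ fccSlots, ⟪A' s, A' w₀⟫_ℝ < 0 → y + A' w₀ + A' s ∈ X := by
    intro s hs hneg
    rw [LinearIsometryEquiv.inner_map_map] at hneg
    rcases eq_neg_or_add_mem_fccSlots_of_inner_neg hw₀ hs hneg with rfl | hsum
    · rw [map_neg, add_neg_cancel_right]; exact hy
    · rw [add_assoc, ← map_add]
      apply occA' _ hsum
      apply adj_le _ hsum
      -- `⟪w₀ + s, w₀⟫ = 1 + ⟪s, w₀⟫ = 1/2`
      have hs1 := norm_eq_one_of_mem_fccSlots hs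
      have hw1 := norm_eq_one_of_mem_fccSlots hw₀
      have hsum1 := norm_eq_one_of_mem_fccSlots hsum
      have e1 : ‖w₀ + s‖ ^ 2 = 2 + 2 * ⟪s, w₀⟫_ℝ := by
        rw [norm_add_sq_real, hs1, hw1, real_inner_comm]; ring
      rw [hsum1] at e1
      rw [inner_add_left, real_inner_self_eq_norm_sq, hw1]
      linarith
  exact ⟨a, ha, b, hb, c, hc, hind, occ a ha ha', occ b hb hb', occ c hc hc'⟩

end Summit.Ventures.Crystal3D.Theorems

end
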